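import Summits.BirchSwinnertonDyer.BirchSwinnertonDyer.Theorems.SylvesterTwoHeegnerIndexUpperOffV0FourTorsionRows
import Summits.BirchSwinnertonDyer.BirchSwinnertonDyer.Theorems.SylvesterTwoHeegnerIndexLowerHalfFourTorsionMembersD
import HarnessLib

/-!
# Route `SylvesterTwoHeegnerIndex` (rung K7t), crux `UpperOffV0HSY` (item 19581): the SHARP sub-list
# of the `(ℤ/4)²`-rows is read off the partner's `L`-VALUE certificate alone — `#Ш_an(E_{3p²})` odd
# ⟹ `Ш(E_{3p²})[2] = 0` (Burungale–Flach) ⟹ the pair inequality has no partner terms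
# (helper toward stmt-BirchSwinnertonDyer-19581; cell «bsd-cm», seat `bsd-cm-k7t-c3` g4; theorems only)

HONEST FRAMING (cell «bsd-cm», `run/shared/lean/pub/bsd-cm/`; FULL-BSD RANK ≤ 1 programme, tranche
1a): the class 𝒞_HSY at `p = 2` (B14 / O12) is OPEN in print and stays open here; item 19581 (the
constant-zero `2`-adic Kolyvagin bound for the Hu–Shu–Yin pair off 𝒱₀) is NOT proved here for any
`p`. THEOREMS ONLY (0 definitions, 0 named facts, 0 `sorry`). Conclusions are CONDITIONAL on the
route's named published facts (Hu–Shu–Yin Thm 1.3/1.4, Burungale–Flach, modularity) and on DISPLAYED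
PER-CURVE CERTIFICATE DATA not proved in the kernel (reading key: part A
`…LowerHalfFourTorsionMembers` header; data CERT14/40/79 + cert252283 on items 19230/19477,
HOME/bsd-cm-k7t-c3/): here only the partner value `hq' : #Ш_an(E_{3p²}) = T′` (two-engine value
`T′ = L(E_{3p²},1)·#tors² / (Ω·∏c_ℓ)`, an odd square at every certified row).

WHAT THIS FILE ADDS to `…UpperOffV0FourTorsionRows` §2 (where the SHARP sub-list — partner
`2`-trivial ⟹ the pair inequality of crux 19581 is the single-curve bound `ord₂ #Ш(E_p)[2^∞] ≤
ord₂ #Ш_an(E_p)` with no slack — was stated under the hypothesis `Ш(E_{3p²})[2] = 0`): that hypothesis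
is DISCHARGED from the `L`-value certificate. Since `A ≅ E_{3p²}` is a CM curve of analytic rank `0`
(Hu–Shu–Yin), Burungale–Flach gives `BSD(A, 2)`, so `ord₂ #Ш(A)[2^∞] = ord₂ #Ш_an(A) = ord₂ T′ = 0`
and `Ш(A)` has no element of order `2` (Cauchy). Hence membership in the sharp sub-list (32 of the 79
rows `p ≤ 4·10⁵`, incl. both `#Ш_an = 64` rows) needs no `2`-descent on `E_{3p²}`; rows `140557`
(`T′ = 169`) and `381181` (`T′ = 529`) — the two LISTED members — are instantiated: there the crux is
`¬ 128 ∣ #Ш(E_p)` (Rows §1, `n = 6`) and ONE sharp `2`-adic Kolyvagin bound over `ℚ(√−3)` for `E_p`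
alone would settle them without a `4`-descent (cell memo two §22.2; nothing asserted about it).

PARTITION (D-0054): CornerF at `2` / O12 × the 79 𝒞_HSY members `p ≤ 4·10⁵` with `(ℤ/4)² ↪ Ш(E_p)`,
sub-list `#Ш(E_{3p²})` odd (32 rows; book230: 0 classes) × `p = 2` — types-the-object-of (certificate
consumer deciding sub-list membership); closes no cell and no class; nothing booked; no label moves.
References (locators only): [BurungaleFlach2024] Thm. 1.1, Cor. 2; [HuShuYin2019] Thm. 1.3/1.4 (p. 3),
Cor. 4.4, (bsd) p. 12; [Miller2011LMS] §1, Def. 1.1; [GrossLMS1991] §§3–5; [Cremona1997] §3.6;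
parents p457115 (Rows), p446549 (part D), p425346 (UpperPairForm).
-/

set_option autoImplicit false
-- the Theorems namespace `Summit.BirchSwinnertonDyer.BirchSwinnertonDyer.…` repeats a component by design (D-0017 layout)
set_option linter.dupNamespace false

noncomputable section

open scoped Classical

open WeierstrassCurve NumberField Literature.NumberTheory.EllipticCurves
  Literature.NumberTheory.EllipticCurves.ModularForms
  Literature.NumberTheory.EllipticCurves.Rank1Residual
  Literature.NumberTheory.EllipticCurves.Rank1Residual.Typed
  Literature.NumberTheory.EllipticCurves.HuShuYin2019
  Summit.BirchSwinnertonDyer.Rank1Residual.P2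
  Summit.BirchSwinnertonDyer.Rank1Residual.X12.Sylvester
  Summit.BirchSwinnertonDyer.BirchSwinnertonDyer.Theses.SylvesterTwoHeegnerIndex

namespace Summit.BirchSwinnertonDyer.BirchSwinnertonDyer.Theorems

namespace SylvesterTwoLowerCert

section SharpCert

variable {p : ℕ}

/-- **`#Ш_an(A)` odd ⟹ `Ш(A)[2] = 0`** for the rank-`0` CM partner. For globally minimal `B ≅ E_p`,
`A ≅ E_{3p²}` (`p` in 𝒞_HSY) with a DISPLAYED certificate `#Ш_an(A) = qA'`, `ord₂ qA' = 0` (the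
two-engine value `T′ = L(E_{3p²},1)/(Ω·∏c_ℓ/#tors²)`, an odd square at every certified row), granted
Hu–Shu–Yin (`L(A,1) ≠ 0`), Burungale–Flach (`BSD(A, 2)` for the analytic-rank-`0` CM curve `A`) and
modularity: `Ш(A)` has no element of order `2`. So membership of a row in the SHARP sub-list of §2 is
decided by the same `L`-value certificate that gives `#Ш_an`, without PARI's `ellrank` on `E_{3p²}`
(whose `s₂′ = 0` it implies). CONDITIONAL; EVIDENCE consumer.
[cite: BurungaleFlach2024, Thm. 1.1 and Cor. 2] [cite: HuShuYin2019, Thm. 1.3 and Thm. 1.4 (p. 3)]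
[cite: Miller2011LMS, §1 and Def. 1.1] -/
theorem partner_twoTorsion_trivial_of_shaAn_odd
    (hHSY : thm14_threePart_product) (hCM0 : bsdTriple_of_hasCM_of_L_one_ne_zero)
    (hmod : hasEntireLFunction_rat)
    (hp : p.Prime) (h9 : p % 9 = 4 ∨ p % 9 = 7) (h3 : ¬ ∃ x : ZMod p, x ^ 3 = 3)
    (A B : WeierstrassCurve ℚ) [A.IsElliptic] [A.IsGloballyMinimal] [B.IsElliptic]
    [B.IsGloballyMinimal] (hB : ∃ C : VariableChange ℚ, C • B = cubeSumCurve (p : ℚ))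
    (hA : ∃ C : VariableChange ℚ, C • A = cubeSumCurve (3 * (p : ℚ) ^ 2))
    {qA' : ℚ} (hqA' : shaAn A = (qA' : ℂ)) (hodd : padicValRat 2 qA' = 0) :
    ∀ z : A.sha, (2 : ℤ) • z = 0 → z = 0 := by
  haveI : Fact (2 : ℕ).Prime := ⟨Nat.prime_two⟩
  obtain ⟨-, hfinA, qB, qA, -, hqA, -, -, hvA⟩ :=
    SylvesterTwoUpper.pair_shaAn_two hHSY hCM0 hmod hp h9 h3 A B hB hA
  haveI := hfinA
  set P := AddCommGroup.primaryComponent A.sha 2 with hP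
  have hqq : qA' = qA := by exact_mod_cast hqA'.symm.trans hqA
  subst hqq
  have hA1 : padicValNat 2 (Nat.card P) = 0 := by
    rw [hodd] at hvA
    exact_mod_cast hvA.symm
  intro z hz
  by_contra hz0
  have hzP : z ∈ P := by
    rw [hP, AddCommGroup.mem_primaryComponent]
    refine ⟨1, ?_⟩
    have : ((2 ^ 1 : ℕ) : ℤ) • z = 0 := by exact_mod_cast hz
    rwa [natCast_zsmul] at this
  have hz2 : (2 : ℕ) • (⟨z, hzP⟩ : P) = 0 := by
    apply Subtype.ext
    have : ((2 : ℕ) : ℤ) • z = 0 := by exact_mod_cast hz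
    rw [natCast_zsmul] at this
    simpa using this
  have hne : (⟨z, hzP⟩ : P) ≠ 0 := fun h => hz0 (congrArg Subtype.val h)
  have hord : addOrderOf (⟨z, hzP⟩ : P) = 2 := addOrderOf_eq_prime hz2 hne
  have hdvd : 2 ^ 1 ∣ Nat.card P := by
    rw [pow_one, ← hord]; exact addOrderOf_dvd_natCard _
  have hcard : Nat.card P ≠ 0 := (Nat.card_pos (α := P)).ne'
  have h1 : 1 ≤ padicValNat 2 (Nat.card P) := (padicValNat_dvd_iff_le hcard).mp hdvd
  omega

/-- **The pair inequality has NO partner terms wherever `#Ш_an(E_{3p²})` is odd.** Same setting, the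
certificate `#Ш_an(A) = qA'` with `ord₂ qA' = 0` displayed: crux 19581's pair inequality at `(A, B)` ⟺
the single-curve statement `ord₂ #Ш(B)[2^∞] ≤ ord₂ #Ш_an(B)` (§2 with its `2`-torsion hypothesis
DISCHARGED from the `L`-value certificate via Burungale–Flach). CONDITIONAL; EVIDENCE consumer.
[cite: BurungaleFlach2024, Thm. 1.1 and Cor. 2] [cite: HuShuYin2019, Cor. 4.4 and (bsd) p. 12]
[cite: Miller2011LMS, §1 and Def. 1.1] [cite: GrossLMS1991, §§3–5] -/
theorem pairBound_iff_single_of_partner_shaAn_odd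
    (hHSY : thm14_threePart_product) (hCM0 : bsdTriple_of_hasCM_of_L_one_ne_zero)
    (hmod : hasEntireLFunction_rat)
    (hp : p.Prime) (h9 : p % 9 = 4 ∨ p % 9 = 7) (h3 : ¬ ∃ x : ZMod p, x ^ 3 = 3)
    (A B : WeierstrassCurve ℚ) [A.IsElliptic] [A.IsGloballyMinimal] [B.IsElliptic]
    [B.IsGloballyMinimal] (hB : ∃ C : VariableChange ℚ, C • B = cubeSumCurve (p : ℚ))
    (hA : ∃ C : VariableChange ℚ, C • A = cubeSumCurve (3 * (p : ℚ) ^ 2))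
    {qA' : ℚ} (hqA' : shaAn A = (qA' : ℂ)) (hodd : padicValRat 2 qA' = 0) :
    (∃ qB qA : ℚ, shaAn B = (qB : ℂ) ∧ shaAn A = (qA : ℂ) ∧ qB * qA ≠ 0 ∧
        (padicValNat 2 (Nat.card (AddCommGroup.primaryComponent B.sha 2)) : ℤ) +
            (padicValNat 2 (Nat.card (AddCommGroup.primaryComponent A.sha 2)) : ℤ) ≤
          padicValRat 2 (qB * qA)) ↔
      ∃ qB : ℚ, shaAn B = (qB : ℂ) ∧ qB ≠ 0 ∧
        (padicValNat 2 (Nat.card (AddCommGroup.primaryComponent B.sha 2)) : ℤ) ≤ padicValRat 2 qB :=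
  pairBound_iff_single_of_partner_twoTorsion_trivial hHSY hCM0 hmod hp h9 h3 A B hB hA
    (partner_twoTorsion_trivial_of_shaAn_odd hHSY hCM0 hmod hp h9 h3 A B hB hA hqA' hodd)

/-- `ord₂` of an odd natural number, read in `ℚ`, is `0`. [folklore] -/
theorem padicValRat_two_natCast_of_odd {m : ℕ} (hm : ¬ 2 ∣ m) : padicValRat 2 ((m : ℕ) : ℚ) = 0 := by
  rw [padicValRat.of_nat, padicValNat.eq_zero_of_not_dvd hm, Nat.cast_zero]

/-- **Certificate consumer, member-generic.** At an 𝒞_HSY parameter `p` with a displayed partner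
certificate `hq' : #Ш_an(A) = T′` for every globally minimal `A ≅ E_{3p²}`, `T′` an ODD natural
number, granted Hu–Shu–Yin, Burungale–Flach and modularity: for all globally minimal `A ≅ E_{3p²}`,
`B ≅ E_p`, `Ш(A)[2] = 0` AND crux 19581's pair inequality at `(A, B)` is the single-curve bound for
`B`. This is the row-level reading of the 32-row SHARP sub-list of §2 (`T′ ∈ {1, 25, 49, 169, 361,
529, 625, 841, 961, 1369, 1681, 2209, 2809, 3481, 3721, 5041, 5329}` there). CONDITIONAL; EVIDENCE
consumer; nothing asserted about the bound itself. [cite: BurungaleFlach2024, Thm. 1.1 and Cor. 2]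
[cite: HuShuYin2019, Thm. 1.3 and Thm. 1.4 (p. 3)] [cite: Miller2011LMS, §1 and Def. 1.1] -/
theorem sharp_row_of_partner_cert_odd
    (hsy : Nat.Prime p ∧ (p % 9 = 4 ∨ p % 9 = 7) ∧ ¬ ∃ x : ZMod p, x ^ 3 = 3)
    (hHSY : thm14_threePart_product) (hCM0 : bsdTriple_of_hasCM_of_L_one_ne_zero)
    (hmod : hasEntireLFunction_rat) {T : ℕ} (hT : ¬ 2 ∣ T)
    (hq' : ∀ (A : WeierstrassCurve ℚ) [A.IsElliptic] [A.IsGloballyMinimal],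
      (∃ C : VariableChange ℚ, C • A = cubeSumCurve (3 * (p : ℚ) ^ 2)) → shaAn A = (((T : ℕ) : ℚ) : ℂ))
    (A B : WeierstrassCurve ℚ) [A.IsElliptic] [A.IsGloballyMinimal] [B.IsElliptic]
    [B.IsGloballyMinimal] (hB : ∃ C : VariableChange ℚ, C • B = cubeSumCurve (p : ℚ))
    (hA : ∃ C : VariableChange ℚ, C • A = cubeSumCurve (3 * (p : ℚ) ^ 2)) :
    (∀ z : A.sha, (2 : ℤ) • z = 0 → z = 0) ∧
      ((∃ qB qA : ℚ, shaAn B = (qB : ℂ) ∧ shaAn A = (qA : ℂ) ∧ qB * qA ≠ 0 ∧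
          (padicValNat 2 (Nat.card (AddCommGroup.primaryComponent B.sha 2)) : ℤ) +
              (padicValNat 2 (Nat.card (AddCommGroup.primaryComponent A.sha 2)) : ℤ) ≤
            padicValRat 2 (qB * qA)) ↔
        ∃ qB : ℚ, shaAn B = (qB : ℂ) ∧ qB ≠ 0 ∧
          (padicValNat 2 (Nat.card (AddCommGroup.primaryComponent B.sha 2)) : ℤ) ≤
            padicValRat 2 qB) := by
  obtain ⟨hpr, h9, h3⟩ := hsy
  have hodd := padicValRat_two_natCast_of_odd hT
  exact ⟨partner_twoTorsion_trivial_of_shaAn_odd hHSY hCM0 hmod hpr h9 h3 A B hB hA (hq' A hA) hodd,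
    pairBound_iff_single_of_partner_shaAn_odd hHSY hCM0 hmod hpr h9 h3 A B hB hA (hq' A hA) hodd⟩

/-- **Row `p = 140557`, partner side** (LISTED member, `#Ш_an(E_{140557}) = 64`; partner certificate
`#Ш_an(E_{3·140557²}) = T′ = 169 = 13²`, kit j252371): granted the facts, for all globally minimal
`A ≅ E_{3·140557²}`, `B ≅ E_{140557}`: `Ш(A)[2] = 0` and crux 19581's pair inequality at `(A, B)` is the
single-curve bound for `B` — the row is on the SHARP sub-list by its `L`-value certificate alone.
CONDITIONAL; EVIDENCE consumer. [cite: BurungaleFlach2024, Thm. 1.1 and Cor. 2]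
[cite: HuShuYin2019, Thm. 1.3 and Thm. 1.4 (p. 3)] [cite: Miller2011LMS, §1 and Def. 1.1] -/
theorem sharp_row_140557 (hF : PublishedFactsTwo)
    (hq' : ∀ (A : WeierstrassCurve ℚ) [A.IsElliptic] [A.IsGloballyMinimal],
      (∃ C : VariableChange ℚ, C • A = cubeSumCurve (3 * ((140557 : ℕ) : ℚ) ^ 2)) →
        shaAn A = (((169 : ℕ) : ℚ) : ℂ))
    (A B : WeierstrassCurve ℚ) [A.IsElliptic] [A.IsGloballyMinimal] [B.IsElliptic]
    [B.IsGloballyMinimal] (hB : ∃ C : VariableChange ℚ, C • B = cubeSumCurve ((140557 : ℕ) : ℚ))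
    (hA : ∃ C : VariableChange ℚ, C • A = cubeSumCurve (3 * ((140557 : ℕ) : ℚ) ^ 2)) :
    (∀ z : A.sha, (2 : ℤ) • z = 0 → z = 0) ∧
      ((∃ qB qA : ℚ, shaAn B = (qB : ℂ) ∧ shaAn A = (qA : ℂ) ∧ qB * qA ≠ 0 ∧
          (padicValNat 2 (Nat.card (AddCommGroup.primaryComponent B.sha 2)) : ℤ) +
              (padicValNat 2 (Nat.card (AddCommGroup.primaryComponent A.sha 2)) : ℤ) ≤
            padicValRat 2 (qB * qA)) ↔
        ∃ qB : ℚ, shaAn B = (qB : ℂ) ∧ qB ≠ 0 ∧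
          (padicValNat 2 (Nat.card (AddCommGroup.primaryComponent B.sha 2)) : ℤ) ≤
            padicValRat 2 qB) := by
  obtain ⟨hHSY, hBF, hmod, -⟩ := hF
  exact sharp_row_of_partner_cert_odd hsy_140557 hHSY hBF hmod (T := 169) (by norm_num) hq' A B hB hA

/-- **Row `p = 381181`, partner side** (LISTED member, `#Ш_an(E_{381181}) = 64`; partner certificate
`#Ш_an(E_{3·381181²}) = T′ = 529 = 23²`, kit j253339): granted the facts, for all globally minimal
`A ≅ E_{3·381181²}`, `B ≅ E_{381181}`: `Ш(A)[2] = 0` and crux 19581's pair inequality at `(A, B)` is the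
single-curve bound for `B`. With §1 (`n = 6`): the crux there ⟺ `¬ 128 ∣ #Ш(E_{381181})`, and a SHARP
`2`-adic Kolyvagin bound over `ℚ(√−3)` for `E_{381181}` alone would settle the LISTED member without a
`4`-descent. CONDITIONAL; EVIDENCE consumer. [cite: BurungaleFlach2024, Thm. 1.1 and Cor. 2]
[cite: HuShuYin2019, Thm. 1.3 and Thm. 1.4 (p. 3)] [cite: Miller2011LMS, §1 and Def. 1.1] -/
theorem sharp_row_381181 (hF : PublishedFactsTwo)
    (hq' : ∀ (A : WeierstrassCurve ℚ) [A.IsElliptic] [A.IsGloballyMinimal],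
      (∃ C : VariableChange ℚ, C • A = cubeSumCurve (3 * ((381181 : ℕ) : ℚ) ^ 2)) →
        shaAn A = (((529 : ℕ) : ℚ) : ℂ))
    (A B : WeierstrassCurve ℚ) [A.IsElliptic] [A.IsGloballyMinimal] [B.IsElliptic]
    [B.IsGloballyMinimal] (hB : ∃ C : VariableChange ℚ, C • B = cubeSumCurve ((381181 : ℕ) : ℚ))
    (hA : ∃ C : VariableChange ℚ, C • A = cubeSumCurve (3 * ((381181 : ℕ) : ℚ) ^ 2)) :
    (∀ z : A.sha, (2 : ℤ) • z = 0 → z = 0) ∧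
      ((∃ qB qA : ℚ, shaAn B = (qB : ℂ) ∧ shaAn A = (qA : ℂ) ∧ qB * qA ≠ 0 ∧
          (padicValNat 2 (Nat.card (AddCommGroup.primaryComponent B.sha 2)) : ℤ) +
              (padicValNat 2 (Nat.card (AddCommGroup.primaryComponent A.sha 2)) : ℤ) ≤
            padicValRat 2 (qB * qA)) ↔
        ∃ qB : ℚ, shaAn B = (qB : ℂ) ∧ qB ≠ 0 ∧
          (padicValNat 2 (Nat.card (AddCommGroup.primaryComponent B.sha 2)) : ℤ) ≤
            padicValRat 2 qB) := by
  obtain ⟨hHSY, hBF, hmod, -⟩ := hF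
  exact sharp_row_of_partner_cert_odd hsy_381181 hHSY hBF hmod (T := 529) (by norm_num) hq' A B hB hA

end SharpCert

end SylvesterTwoLowerCert

end Summit.BirchSwinnertonDyer.BirchSwinnertonDyer.Theorems

end
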